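import Summits.ResolutionOfSingularities.ResolutionOfSingularities.Theorems.NoZeno.Negative.NoZenoValuativeSkeleton

/-!
# Crux `NoZeno` (stmt-ResolutionOfSingularities-16483) — the hypothesis `A.FG` is load-bearing
# (for the conclusion and for `StrictDrop`; deleting it from the whole crux makes the crux VACUOUS)

Route `ResolutionOfSingularities/HomologicalConductor`, crux
`Summit.ResolutionOfSingularities.ResolutionOfSingularities.Theses.HomologicalConductor.NoZeno`
= `Persistence → StrictDrop → Termination` (valuative termination of the canonical normalised
`ca`-tower `T₀ = A_centre`, `T_(m+1) = (normalisation of T_m[ca(T_m)/x])_centre`). Negative lane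
(`--supports` the crux item); no Theses decl is asserted.

Witness throughout: `p = 2`, `k = 𝔽₂`, `K = HahnSeries ℚ 𝔽₂`, `O = {0 ≤ order}` (rank one,
non-discrete, NOT noetherian: `NoZenoValuativeSkeleton.lean`), and `A := O` itself as a
`k`-subalgebra — admissible for every hypothesis of the crux's datum EXCEPT `A.FG`
(`Frac O = K`, `k ⊆ O`, `A ⊆ O`).

* `noZeno_tower_eq_self_of_valuationSubring` (positive, verbatim the route's `let`-tower): for
  `A = O` the canonical tower is CONSTANT, `T_m = O` for all `m` — `loc` inverts only `O`-units,
  every `chart` generator `c·x⁻¹` lies in `O` by the admissibility clause `∀ c' ∈ ca, c'·x⁻¹ ∈ O`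
  ALONE (nothing about `ca` is used), and `nrm` adds nothing (`O` is integrally closed). No junk
  progress, whatever `ca(O)` is.
* `noZeno_termination_false_without_fg` — the conclusion of `NoZeno` (= the antecedent of
  `Globalisation`, = `CruxAttack.Termination`) with the single hypothesis `A.FG` deleted is FALSE:
  `T_m = O` is never `IsRegularLocalRing` (not noetherian). Moral: finite generation is consumed
  (route constraint C4) at least through "every `T_m` is noetherian"; `IsRegularLocalRing` cannot
  even be stated usefully without it.
* `noZeno_strictDrop_false_without_fg` — the sibling hypothesis `StrictDrop` with `A.FG` deleted is
  FALSE at the same witness (the tower idles at a non-regular ring, so no `y` can undercut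
  `x := y`).
* `noZenoWithoutFG_holds_vacuously` — hence the crux with `A.FG` deleted EVERYWHERE
  (`Persistence⁻ → StrictDrop⁻ → Termination⁻`) is TRUE for the wrong reason. This is the concrete
  face of the structural fact recorded in `Cruxes/NoZeno/CruxAttack.lean` (`not_noZeno_iff`:
  the crux's truth value is hostage to its two GLOBAL hypotheses): hypothesis surgery on `NoZeno`
  must be done on `Termination`, not on the implication.

Kernel-only (axioms `propext`, `Classical.choice`, `Quot.sound`); no `def`, no named fact.
-/

set_option linter.dupNamespace false

noncomputable section

namespace Summit.ResolutionOfSingularities.ResolutionOfSingularities.Theorems.NoZeno.Negative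

open HahnSeries

/-! ## The three tower operations fix a subalgebra that is the valuation ring -/

section Tower

variable {k K : Type} [Field k] [Field K] [Algebra k K]

/-- `loc` (localise at the centre of `O`) fixes a `k`-subalgebra that IS `O`: the admissible
denominators `s` (`s⁻¹ ∈ O`) are units of `O` or `0`. Verbatim the route's `let loc` body.
[folklore] -/
theorem noZeno_loc_eq_self_of_valuationSubring (O : ValuationSubring K) (A : Subalgebra k K)
    (hAO : ∀ x, x ∈ A ↔ x ∈ O) :
    Algebra.adjoin k {y : K | ∃ a ∈ A, ∃ s ∈ A, s⁻¹ ∈ O ∧ y = a * s⁻¹} = A := by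
  refine le_antisymm (Algebra.adjoin_le ?_) (fun a ha => Algebra.subset_adjoin ?_)
  · rintro y ⟨a, ha, s, -, hsO, rfl⟩
    exact A.mul_mem ha ((hAO _).mpr hsO)
  · exact ⟨a, ha, 1, A.one_mem, by rw [inv_one]; exact O.one_mem, by rw [inv_one, mul_one]⟩

/-- `chart` (affine chart of the blow-up of the centre `c`, admissible denominators `x` with
`c · x⁻¹ ⊆ O`) fixes every `k`-subalgebra CONTAINING `O`, WHATEVER the set `c` is: the
admissibility clause alone puts each new generator `c₁ * x⁻¹` in `O`. Verbatim the route's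
`let chart` body with `ca A` generalised to an arbitrary `c`. [folklore] -/
theorem noZeno_chart_eq_self_of_valuationSubring_le (O : ValuationSubring K) (A : Subalgebra k K)
    (hOA : ∀ x, x ∈ O → x ∈ A) (c : Set K) :
    Algebra.adjoin k ((A : Set K) ∪ {y : K | ∃ c₁ ∈ c, ∃ x ∈ c, x ≠ 0 ∧
      (∀ c' ∈ c, c' * x⁻¹ ∈ O) ∧ y = c₁ * x⁻¹}) = A := by
  refine le_antisymm (Algebra.adjoin_le ?_)
    (fun a ha => Algebra.subset_adjoin (Set.mem_union_left _ ha))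
  rintro y (hy | ⟨c₁, hc₁, x, -, -, hadm, rfl⟩)
  · exact hy
  · exact hOA _ (hadm c₁ hc₁)

/-- `nrm` (normalise inside `K`) fixes a `k`-subalgebra that IS `O`: valuation rings are
integrally closed (`Valuation.Integers.mem_of_integral` for `O.valuation`). Verbatim the route's
`let nrm` body. [folklore] -/
theorem noZeno_nrm_eq_self_of_valuationSubring (O : ValuationSubring K) (A : Subalgebra k K)
    (hAO : ∀ x, x ∈ A ↔ x ∈ O) :
    Algebra.adjoin k {y : K | IsIntegral ↥A y} = A := by
  have hv : O.valuation.Integers ↥A :=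
    { hom_inj := fun a b h => Subtype.ext h
      map_le_one := fun a => (O.valuation_le_one_iff _).mpr ((hAO _).mp a.2)
      exists_of_le_one := fun r hr =>
        ⟨⟨r, (hAO r).mpr ((O.valuation_le_one_iff r).mp hr)⟩, rfl⟩ }
  refine le_antisymm (Algebra.adjoin_le ?_) (fun a ha => Algebra.subset_adjoin ?_)
  · intro y hy
    have h := hv.mem_of_integral hy
    rw [Valuation.mem_integer_iff] at h
    exact (hAO y).mpr ((O.valuation_le_one_iff y).mp h)
  · show IsIntegral ↥A a
    exact isIntegral_algebraMap (R := ↥A) (A := K) (x := ⟨a, ha⟩)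

end Tower

/-- **The canonical tower started at a valuation ring is constant.** For a field `k`, a
valuation ring `O` of `K` and the `k`-subalgebra `A = O`: `T_m = A` for every `m`, where
`T₀ = loc A`, `T_(m+1) = loc (nrm (chart T_m))` is VERBATIM the route's `let`-tower (the
statement re-binds `ca, loc, chart, nrm, tower` with the bodies of `HomologicalConductor.NoZeno`).
Nothing about the cohomology annihilator `ca` is used. [folklore] -/
theorem noZeno_tower_eq_self_of_valuationSubring : ∀ (k K : Type) [Field k] [Field K] [Algebra k K] (O : ValuationSubring K) (A : Subalgebra k K), (∀ x, x ∈ A ↔ x ∈ O) → let ca : Subalgebra k K → Set K := fun A => {x : K | ∃ hx : x ∈ A, ∃ n : ℕ, ∀ i : ℕ, n ≤ i → ∀ (M N : ModuleCat.{0} ↥A), Module.Finite ↥A M → Module.Finite ↥A N → ∀ e : CategoryTheory.Abelian.Ext.{0} M N i, (⟨x, hx⟩ : ↥A) • e = 0}; let loc : Subalgebra k K → Subalgebra k K := fun A => Algebra.adjoin k {y : K | ∃ a ∈ A, ∃ s ∈ A, s⁻¹ ∈ O ∧ y = a * s⁻¹}; let chart : Subalgebra k K → Subalgebra k K := fun A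 => Algebra.adjoin k ((A : Set K) ∪ {y : K | ∃ c ∈ ca A, ∃ x ∈ ca A, x ≠ 0 ∧ (∀ c' ∈ ca A, c' * x⁻¹ ∈ O) ∧ y = c * x⁻¹}); let nrm : Subalgebra k K → Subalgebra k K := fun B => Algebra.adjoin k {y : K | IsIntegral ↥B y}; let tower : Subalgebra k K → ℕ → Subalgebra k K := fun A m => @Nat.rec (fun _ => Subalgebra k K) (loc A) (fun _ B => loc (nrm (chart B))) m; ∀ m : ℕ, tower A m = A := by
  intro k K _ _ _ O A hAO ca loc chart nrm tower m
  induction m with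
  | zero => exact noZeno_loc_eq_self_of_valuationSubring O A hAO
  | succ n ih =>
    show loc (nrm (chart (tower A n))) = A
    rw [ih]
    have h1 : chart A = A :=
      noZeno_chart_eq_self_of_valuationSubring_le O A (fun x hx => (hAO x).mpr hx) (ca A)
    rw [h1]
    have h2 : nrm A = A := noZeno_nrm_eq_self_of_valuationSubring O A hAO
    rw [h2]
    exact noZeno_loc_eq_self_of_valuationSubring O A hAO

/-- The witness datum: over `k = 𝔽₂`, `K = HahnSeries ℚ 𝔽₂`, a NON-noetherian valuation ring
`O ∋ 𝔽₂` and a `k`-subalgebra `A` with the same elements as `O` and `Frac A = K` — admissible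
for every hypothesis of the crux's datum except `A.FG`. Existence form. [folklore] -/
theorem noZeno_exists_nonFG_datum : ∃ (O : ValuationSubring (HahnSeries ℚ (ZMod 2)))
    (A : Subalgebra (ZMod 2) (HahnSeries ℚ (ZMod 2))),
    ¬ IsNoetherianRing O ∧ (∀ c : ZMod 2, algebraMap (ZMod 2) (HahnSeries ℚ (ZMod 2)) c ∈ O) ∧
    IsFractionRing ↥A (HahnSeries ℚ (ZMod 2)) ∧ A.toSubring ≤ O.toSubring ∧
    (∀ x, x ∈ A ↔ x ∈ O) ∧ ¬ IsNoetherianRing ↥A := by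
  obtain ⟨O, hO⟩ := noZeno_exists_hahnValuationSubring ℚ (ZMod 2)
  have hOnn : ¬ IsNoetherianRing O := noZeno_hahnValuationSubring_not_isNoetherianRing (ZMod 2) O hO
  have h01 : ∀ c : ZMod 2, c = 0 ∨ c = 1 := by decide
  have hk : ∀ c : ZMod 2, algebraMap (ZMod 2) (HahnSeries ℚ (ZMod 2)) c ∈ O := by
    intro c
    rcases h01 c with rfl | rfl
    · rw [map_zero]; exact O.zero_mem
    · rw [map_one]; exact O.one_mem
  let A : Subalgebra (ZMod 2) (HahnSeries ℚ (ZMod 2)) :=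
    { O.toSubring.toSubsemiring with algebraMap_mem' := hk }
  have hAO : ∀ x, x ∈ A ↔ x ∈ O := fun x => Iff.rfl
  have hv : O.valuation.Integers ↥A :=
    { hom_inj := fun a b h => Subtype.ext h
      map_le_one := fun a => (O.valuation_le_one_iff _).mpr ((hAO _).mp a.2)
      exists_of_le_one := fun r hr =>
        ⟨⟨r, (hAO r).mpr ((O.valuation_le_one_iff r).mp hr)⟩, rfl⟩ }
  let e : ↥A ≃+* ↥O :=
    { toFun := fun a => ⟨a.1, a.2⟩
      invFun := fun b => ⟨b.1, b.2⟩
      left_inv := fun a => rfl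
      right_inv := fun b => rfl
      map_mul' := fun a b => rfl
      map_add' := fun a b => rfl }
  refine ⟨O, A, hOnn, hk, hv.isFractionRing, fun x hx => (hAO x).mp hx, hAO, fun hN => ?_⟩
  haveI := hN
  exact hOnn (isNoetherianRing_of_ringEquiv _ e)

/-- **`A.FG` is load-bearing for the conclusion of `NoZeno`.** The conclusion (`Termination`:
along every valuation ring the canonical tower reaches a regular local ring), with the single
hypothesis `A.FG` deleted and everything else verbatim, is FALSE: at the datum `A = O` of
`noZeno_exists_nonFG_datum` the tower is constantly `O`
(`noZeno_tower_eq_self_of_valuationSubring`), which is not noetherian, let alone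
`IsRegularLocalRing`. [folklore] -/
theorem noZeno_termination_false_without_fg : ¬ (∀ p : ℕ, p.Prime → ∀ (k K : Type) [Field k] [CharP k p] [Field K] [Algebra k K] (O : ValuationSubring K) (A : Subalgebra k K), (∀ c : k, algebraMap k K c ∈ O) → IsFractionRing ↥A K → A.toSubring ≤ O.toSubring → let ca : Subalgebra k K → Set K := fun A => {x : K | ∃ hx : x ∈ A, ∃ n : ℕ, ∀ i : ℕ, n ≤ i → ∀ (M N : ModuleCat.{0} ↥A), Module.Finite ↥A M → Module.Finite ↥A N → ∀ e : CategoryTheory.Abelian.Ext.{0} M N i, (⟨x, hx⟩ : ↥A) • e = 0}; let loc : Subalgebra k K → Subalgebra k K := fun A => Algebra.adjoin k {y : K | ∃ a ∈ A, ∃ s ∈ A, s⁻¹ ∈ O ∧ y = a * s⁻¹}; let chart : Subalgebra k K → Subalgebra k K := fun A => Algebra.adjoin k ((A : Set K) ∪ {y : K | ∃ c ∈ ca A, ∃ x ∈ ca A, x ≠ 0 ∧ (∀ c' ∈ ca A, c' * x⁻¹ ∈ O) ∧ y = c * x⁻¹}); let nrm : Subalgebra k K → Subalgebra k K := fun B =>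 Algebra.adjoin k {y : K | IsIntegral ↥B y}; let tower : Subalgebra k K → ℕ → Subalgebra k K := fun A m => @Nat.rec (fun _ => Subalgebra k K) (loc A) (fun _ B => loc (nrm (chart B))) m; ∃ m : ℕ, IsRegularLocalRing ↥(tower A m)) := by
  intro h
  obtain ⟨O, A, -, hk, hfr, hle, hAO, hAnn⟩ := noZeno_exists_nonFG_datum
  obtain ⟨m, hm⟩ := h 2 Nat.prime_two (ZMod 2) (HahnSeries ℚ (ZMod 2)) O A hk hfr hle
  have hE := noZeno_tower_eq_self_of_valuationSubring (ZMod 2) (HahnSeries ℚ (ZMod 2)) O A hAO m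
  haveI := hm
  exact hAnn (isNoetherianRing_of_ringEquiv _ (Subalgebra.equivOfEq _ _ hE).toRingEquiv)

/-- **`A.FG` is load-bearing for `StrictDrop` too.** The body of the sibling crux `StrictDrop`
with the single hypothesis `A.FG` deleted is FALSE: at `A = O` (non-noetherian) every `T_m = O`
is non-regular, and a drop at stage `0` would need a nonzero `y ∈ ca(T_(m')) = ca(O) = ca(T₀)`
with `y * y⁻¹ = 1 ∉ O`. [folklore] -/
theorem noZeno_strictDrop_false_without_fg : ¬ (∀ p : ℕ, p.Prime → ∀ (k K : Type) [Field k] [CharP k p] [Field K] [Algebra k K] (O : ValuationSubring K) (A : Subalgebra k K), (∀ c : k, algebraMap k K c ∈ O) → IsFractionRing ↥A K → A.toSubring ≤ O.toSubring → let ca : Subalgebra k K → Set K := fun A => {x : K | ∃ hx : x ∈ A, ∃ n : ℕ, ∀ i : ℕ, n ≤ i → ∀ (M N : ModuleCat.{0} ↥A), Module.Finite ↥A M → Module.Finite ↥A N → ∀ e : CategoryTheory.Abelian.Ext.{0} M N i, (⟨x, hx⟩ : ↥A) • e = 0}; let loc : Subalgebra k K → Subalgebra k K := fun A => Algebra.adjoin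 k {y : K | ∃ a ∈ A, ∃ s ∈ A, s⁻¹ ∈ O ∧ y = a * s⁻¹}; let chart : Subalgebra k K → Subalgebra k K := fun A => Algebra.adjoin k ((A : Set K) ∪ {y : K | ∃ c ∈ ca A, ∃ x ∈ ca A, x ≠ 0 ∧ (∀ c' ∈ ca A, c' * x⁻¹ ∈ O) ∧ y = c * x⁻¹}); let nrm : Subalgebra k K → Subalgebra k K := fun B => Algebra.adjoin k {y : K | IsIntegral ↥B y}; let tower : Subalgebra k K → ℕ → Subalgebra k K := fun A m => @Nat.rec (fun _ => Subalgebra k K) (loc A) (fun _ B => loc (nrm (chart B))) m; ∀ m : ℕ, ¬ IsRegularLocalRing ↥(tower A m) → ∃ m' : ℕ, m < m' ∧ ∃ y ∈ ca (tower A m'), y ≠ 0 ∧ ∀ x ∈ ca (tower A m), x ≠ 0 → y * x⁻¹ ∉ O) := by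
  intro h
  obtain ⟨O, A, -, hk, hfr, hle, hAO, hAnn⟩ := noZeno_exists_nonFG_datum
  have hE := noZeno_tower_eq_self_of_valuationSubring (ZMod 2) (HahnSeries ℚ (ZMod 2)) O A hAO
  have h0 := h 2 Nat.prime_two (ZMod 2) (HahnSeries ℚ (ZMod 2)) O A hk hfr hle
  have hbad := h0 0 (fun hreg => by
    haveI := hreg
    exact hAnn (isNoetherianRing_of_ringEquiv _ (Subalgebra.equivOfEq _ _ (hE 0)).toRingEquiv))
  obtain ⟨m', -, y, hy, hy0, hlt⟩ := hbad
  have hEm : _ = A := hE m'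
  have hE0 : _ = A := hE 0
  beta_reduce at hy hlt hEm hE0
  rw [hEm] at hy
  rw [hE0] at hlt
  exact hlt y hy hy0 (by rw [mul_inv_cancel₀ hy0]; exact O.one_mem)

/-- **Deleting `A.FG` from the whole crux makes it VACUOUSLY TRUE.** `NoZeno` with `A.FG`
deleted from its two hypotheses and its conclusion alike (everything else verbatim) holds,
because its second hypothesis is then false (`noZeno_strictDrop_false_without_fg`) — although
its conclusion is false as well (`noZeno_termination_false_without_fg`). Hypothesis surgery on
this crux is only meaningful on the conclusion (`Termination`), cf. `not_noZeno_iff` in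
`Cruxes/NoZeno/CruxAttack.lean`. [folklore] -/
theorem noZenoWithoutFG_holds_vacuously : (∀ p : ℕ, p.Prime → ∀ (k K : Type) [Field k] [CharP k p] [Field K] [Algebra k K] (O : ValuationSubring K) (A : Subalgebra k K), (∀ c : k, algebraMap k K c ∈ O) → IsFractionRing ↥A K → A.toSubring ≤ O.toSubring → let ca : Subalgebra k K → Set K := fun A => {x : K | ∃ hx : x ∈ A, ∃ n : ℕ, ∀ i : ℕ, n ≤ i → ∀ (M N : ModuleCat.{0} ↥A), Module.Finite ↥A M → Module.Finite ↥A N → ∀ e : CategoryTheory.Abelian.Ext.{0} M N i, (⟨x, hx⟩ : ↥A) • e = 0}; let loc : Subalgebra k K → Subalgebra k K := fun A => Algebra.adjoin k {y : K | ∃ a ∈ A, ∃ s ∈ A, s⁻¹ ∈ O ∧ y = a * s⁻¹}; let chart : Subalgebra k K → Subalgebra k K := fun A => Algebra.adjoin k ((A : Set K) ∪ {y : K | ∃ c ∈ ca A, ∃ x ∈ ca A, x ≠ 0 ∧ (∀ c' ∈ ca A, c' * x⁻¹ ∈ O) ∧ y = c * x⁻¹}); let nrm : Subalgebra k K → Subalgebra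 k K := fun B => Algebra.adjoin k {y : K | IsIntegral ↥B y}; let tower : Subalgebra k K → ℕ → Subalgebra k K := fun A m => @Nat.rec (fun _ => Subalgebra k K) (loc A) (fun _ B => loc (nrm (chart B))) m; ∀ m : ℕ, ca (tower A m) ⊆ ca (tower A (m + 1))) → (∀ p : ℕ, p.Prime → ∀ (k K : Type) [Field k] [CharP k p] [Field K] [Algebra k K] (O : ValuationSubring K) (A : Subalgebra k K), (∀ c : k, algebraMap k K c ∈ O) → IsFractionRing ↥A K → A.toSubring ≤ O.toSubring → let ca : Subalgebra k K → Set K := fun A => {x : K | ∃ hx : x ∈ A, ∃ n : ℕ, ∀ i : ℕ, n ≤ i → ∀ (M N : ModuleCat.{0} ↥A), Module.Finite ↥A M → Module.Finite ↥A N → ∀ e : CategoryTheory.Abelian.Ext.{0} M N i, (⟨x, hx⟩ : ↥A) • e = 0}; let loc : Subalgebra k K → Subalgebra k K := fun A => Algebra.adjoin k {y : K | ∃ a ∈ A, ∃ s ∈ A, s⁻¹ ∈ O ∧ y = a * s⁻¹}; let chart : Subalgebra k K → Subalgebra k K := fun A => Algebra.adjoin k ((A : Set K) ∪ {y : K | ∃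 c ∈ ca A, ∃ x ∈ ca A, x ≠ 0 ∧ (∀ c' ∈ ca A, c' * x⁻¹ ∈ O) ∧ y = c * x⁻¹}); let nrm : Subalgebra k K → Subalgebra k K := fun B => Algebra.adjoin k {y : K | IsIntegral ↥B y}; let tower : Subalgebra k K → ℕ → Subalgebra k K := fun A m => @Nat.rec (fun _ => Subalgebra k K) (loc A) (fun _ B => loc (nrm (chart B))) m; ∀ m : ℕ, ¬ IsRegularLocalRing ↥(tower A m) → ∃ m' : ℕ, m < m' ∧ ∃ y ∈ ca (tower A m'), y ≠ 0 ∧ ∀ x ∈ ca (tower A m), x ≠ 0 → y * x⁻¹ ∉ O) → ∀ p : ℕ, p.Prime → ∀ (k K : Type) [Field k] [CharP k p] [Field K] [Algebra k K] (O : ValuationSubring K) (A : Subalgebra k K), (∀ c : k, algebraMap k K c ∈ O) → IsFractionRing ↥A K → A.toSubring ≤ O.toSubring → let ca : Subalgebra k K → Set K := fun A => {x : K | ∃ hx : x ∈ A, ∃ n : ℕ, ∀ i : ℕ, n ≤ i → ∀ (M N : ModuleCat.{0} ↥A), Module.Finite ↥A M → Module.Finite ↥A N → ∀ e : CategoryTheory.Abelian.Ext.{0}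 M N i, (⟨x, hx⟩ : ↥A) • e = 0}; let loc : Subalgebra k K → Subalgebra k K := fun A => Algebra.adjoin k {y : K | ∃ a ∈ A, ∃ s ∈ A, s⁻¹ ∈ O ∧ y = a * s⁻¹}; let chart : Subalgebra k K → Subalgebra k K := fun A => Algebra.adjoin k ((A : Set K) ∪ {y : K | ∃ c ∈ ca A, ∃ x ∈ ca A, x ≠ 0 ∧ (∀ c' ∈ ca A, c' * x⁻¹ ∈ O) ∧ y = c * x⁻¹}); let nrm : Subalgebra k K → Subalgebra k K := fun B => Algebra.adjoin k {y : K | IsIntegral ↥B y}; let tower : Subalgebra k K → ℕ → Subalgebra k K := fun A m => @Nat.rec (fun _ => Subalgebra k K) (loc A) (fun _ B => loc (nrm (chart B))) m; ∃ m : ℕ, IsRegularLocalRing ↥(tower A m) :=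
  fun _ hD => absurd hD noZeno_strictDrop_false_without_fg

end Summit.ResolutionOfSingularities.ResolutionOfSingularities.Theorems.NoZeno.Negative

end
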